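import Summits.ValiantsHypothesis.ValiantsHypothesis.Theses.DivisionGap
import Literature.Barriers.ValiantsHypothesis.MonotoneGapMatrixTree
import Literature.Computability.AlgebraicComplexity.ArithCircuitProofs
import Literature.Computability.AlgebraicComplexity.IMMInVPProofs
import Summits.ValiantsHypothesis.ValiantsHypothesis.Theorems.DivisionGapStDivisionEasy
import Summits.ValiantsHypothesis.ValiantsHypothesis.Theorems.DivisionGapZeroOneTransferSpanOfCertificate
import Summits.ValiantsHypothesis.ValiantsHypothesis.Theorems.DivisionGapZeroOneTransferDivSubstClosure
import Summits.ValiantsHypothesis.ValiantsHypothesis.Theorems.DivisionGapZeroOneTransferSparsePolyComplexity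
import Summits.ValiantsHypothesis.ValiantsHypothesis.Theorems.ZeroOneTransfer.Negative.FalseWithoutVP
import Summits.ValiantsHypothesis.ValiantsHypothesis.Theorems.ZeroOneTransfer.Negative.NoDivisionFalse
import Summits.ValiantsHypothesis.ValiantsHypothesis.Theorems.ZeroOneTransfer.Negative.LowDegreeCofactor

/-!
# Line `hidden-markov-intertwiner` — skeleton for crux `ZeroOneTransfer` (stmt-ValiantsHypothesis-5066)
# (lead c3, 2026-08-16: RESHAPED at registration — bet = `stub_forestQuotient`, engine split in two)

Route `DivisionGap`, crux H2 = `Summit.ValiantsHypothesis.ValiantsHypothesis.Theses.DivisionGap.ZeroOneTransfer`: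
every p-family `f_n ∈ ℝ≥0[σ_n]` with coefficients in `{0,1}` whose complexification is in `VP_ℂ`
has quasi-polynomially bounded division complexity `min_{h ≠ 0} L₊(f_n·h) + L₊(h)`.

Idea card `Cruxes/ZeroOneTransfer/Ideas/hidden-markov-intertwiner.md`, line card
`Cruxes/ZeroOneTransfer/Lines/hidden-markov-intertwiner.md` (planner's skeleton: stubs `stub_realification`,
`stub_hiddenMarkovUniversality`, `stub_subMarkovDetDivisionEasy`).  THE LINE: a 0/1 `VP_ℂ` family is a FOREST
QUOTIENT — `ST_m(χ) = ST_m(ψ) · f_n · ST_m(φ)` in `ℝ≥0[σ_n]` with `ST_m(φ) := aeval φ (stPoly ℝ≥0 m)` the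
arborescence polynomial of the complete rooted digraph on `m` non-root nodes under a SPARSE monotone
substitution `φ` of its arc variables (`m`, number of monomials and degree of every datum quasi-polynomial) —
and forest polynomials under sparse substitution are DIVISION-EASY (star–mesh elimination,
FominGrigorievKoshevoy2014 Thm 7.2, made uniform over the data), while quotients/products of division-easy
polynomials are division-easy.

## Reshape (lead c3) — what changed with respect to the planner's skeleton and why

* The registered bet is `stub_forestQuotient` (the card's named RESHAPE TARGET `ForestQuotient`, the `J = 1`
  forest-quotient normal form that the composition actually consumes), stated with the crux's OWN hypothesis
  (`IsVPFamily` over `ℂ` of `f ⊗ ℂ`).  The planner's two-sided matrix statement `HiddenMarkovUniversality`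
  (a polynomial matrix `A` with `det A = f_n` and sub-Markov intertwiners `L(ψ)·A·L(φ) = L(χ)` at MATRIX level)
  is kept as a definition and `forestQuotient_of_hiddenMarkovUniversality` stays a theorem, but it is no longer a
  stub: its surplus over `ForestQuotient` is not implied by the crux even with a degree clause and may fail on
  monotone-EASY dense families (card: column-local ansätze die on strips of width `≥ 4`), so a kill there would
  be a costume kill.  With the `ℂ`-hypothesis the realification stub disappears from the composition.
* The engine `SubMarkovDetDivisionEasy` (card, verbatim) is now a THEOREM of two registered stubs:
  `stub_divSubstClosure` — division certificates transport along ARBITRARY monotone polynomial substitutions,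
  zero data included (bottom forms, `complexity_aeval_le`) — and `stub_sparsePolyComplexity` —
  `L(q) ≤ 2T² + 2T` for `q` with `≤ T` monomials of degree `≤ T` —, composed with the tree's star–mesh
  certificate `Summit.ValiantsHypothesis.DivisionGap.exists_stPoly_mul` (landed with item StDivisionEasy).
* Converse normal form (proved here): `forestQuotient_of_span` — a positive `ST`-span `f_n · A = B`
  (`A, B ∈ Proj(ST_N)`, `A ≠ 0`, `N` quasi-polynomial) IS a forest quotient (`ψ :=` unit data, `ST_m(ψ) = 1`);
  with the tree's `span_of_zeroOneTransferDeg` (p96452) this gives `forestQuotient_of_zeroOneTransferDeg`: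
  the bet is implied by the crux WITH a quasi-polynomial cofactor-degree clause, exactly like S2 of line
  `arborescence-span` — the two Laplacian lines are one.

## Stubs (registered; after wave 1 the ONLY `sorry` is the bet)

* `stub_forestQuotient` (THE BET, crux-strength up to the cofactor-degree clause) — OPEN.
* `stub_divSubstClosure` (M) — `∀ p φ h, h ≠ 0 → ∃ h' ≠ 0, L(p(φ)·h') ≤ L(p·h) + Σ_i L(φ i) ∧ L(h') ≤ L(h) + Σ_i L(φ i)`
  — LANDED p107876 (`Theorems/DivisionGapZeroOneTransferDivSubstClosure.lean`), imported.
* `stub_sparsePolyComplexity` (S) — `#supp q ≤ T → deg q ≤ T → L(q) ≤ 2·T·T + 2·T`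
  — LANDED p108190 (`Theorems/DivisionGapZeroOneTransferSparsePolyComplexity.lean`), imported.

## Proved here (no `sorry`)

`det_pencil`, `forest_ne_zero`, `forest_identity`, `forestQuotient_of_hiddenMarkovUniversality`,
`forest_unit`, `forestQuotient_of_span`, `forestQuotient_of_zeroOneTransferDeg`, `qp_arith`, `arith_engine`,
`subMarkovDetDivisionEasy_of`, `divisionEasy_of_forestQuotient`, `ZeroOneTransfer_of` (the composition, BY NAME).

## Disproof.lean obligations honoured

(A) `VP` is used (hypothesis of the bet; without p-boundedly many variables `ForestQuotient` is false for
`f_n = Σ_{i ≤ N(n)} x_i`, `N` super-qp).  (B) division is used: the cofactor is `ST(φ)h₁·ST(ψ)h₂·h₃`, never `1`.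
(B2)/(E) the cofactor has degree `≈ m · deg(data) ≥ deg f` and spreads over all rows (forest polynomials × pivots) —
the only regime `Negative/LowDegreeCofactor`, `Negative/Polya`, `Negative/KillRows` leave open.  (C) the decisive
instance of the bet is the triangular-lattice dimer family `D_n` of crux 5067 (`Negative/FalseOfTriangularDimersHard`).
(G) `Negative/Exchange*`: positive PROJECTIONS of `ST` are too rigid (`x_a x_b + x_c x_d`, dimer sums, `ST_a + ST_b`
are not projections); the bet uses sparse POLYNOMIAL data and a denominator, for which no exchange obstruction is known.
-/

noncomputable section

namespace Summit.ValiantsHypothesis.ValiantsHypothesis.Cruxes.ZeroOneTransfer.HiddenMarkovIntertwiner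

open Literature.Computability.AlgebraicComplexity Literature.Barriers.ValiantsHypothesis
open MvPolynomial
open scoped NNReal

set_option linter.unusedVariables false
set_option linter.dupNamespace false

/-! ### Vocabulary of the line (abbreviations; the stubs below are spelled out over tree declarations) -/

/-- The sub-Markov ("DZ") pencil with data `φ`: the reduced Kirchhoff matrix `stLaplacian ℝ m` of the
complete digraph on `Option (Fin m)` (root `none`) with the arc variable `x_{(i,v)}` replaced by the
polynomial `φ (i,v) ∈ ℝ≥0[τ]` (slack of node `i` = `φ (i, none)`, conductance `i → j` = `φ (i, some j)`).
[folklore] -/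
def pencil {m : ℕ} {τ : Type} (φ : Fin m × Option (Fin m) → MvPolynomial τ ℝ≥0) :
    Matrix (Fin m) (Fin m) (MvPolynomial τ ℝ) :=
  (stLaplacian ℝ m).map (MvPolynomial.bind₁ fun e => MvPolynomial.map NNReal.toRealHom (φ e))

/-- The forest (arborescence) polynomial of the data `φ`: `ST_m` with `x_{(i,v)} ↦ φ (i,v)`, a
polynomial with nonnegative coefficients. [folklore] -/
def forest {m : ℕ} {τ : Type} (φ : Fin m × Option (Fin m) → MvPolynomial τ ℝ≥0) : MvPolynomial τ ℝ≥0 :=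
  MvPolynomial.aeval φ (stPoly ℝ≥0 m)

/-! ### The statements of the line (named `Prop`s) -/

/-- The planner's two-sided hidden-Markov universality (`C⁺` of the card), here with the crux's `ℂ`-hypothesis;
NO LONGER A STUB (see the module docstring): for every 0/1 family with `f ⊗ ℂ ∈ VP_ℂ` there is `c` such that for
every `n` there are `m ≤ 2^{(log₂ n + c)^c}`, a matrix `A ∈ ℝ[σ_n]^{m×m}` with `det A = f_n ⊗ ℝ`, and sparse data
`φ, ψ, χ` with `L(ψ) · A · L(φ) = L(χ)`, `det L(φ) ≠ 0`, `det L(ψ) ≠ 0`.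
[cite: FominGrigorievKoshevoy2014, Thm 7.2 and Remark 1.5] -/
def HiddenMarkovUniversality : Prop :=
  ∀ (σ : ℕ → Type) [∀ n, Fintype (σ n)] (f : ∀ n, MvPolynomial (σ n) NNReal),
    (∀ n m, MvPolynomial.coeff m (f n) = 0 ∨ MvPolynomial.coeff m (f n) = 1) →
    Literature.Computability.AlgebraicComplexity.IsVPFamily (k := ℂ)
      (fun n => MvPolynomial.map (Complex.ofRealHom.comp NNReal.toRealHom) (f n)) →
    ∃ c : ℕ, ∀ n : ℕ, ∃ (m : ℕ) (A : Matrix (Fin m) (Fin m) (MvPolynomial (σ n) ℝ))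
      (φ ψ χ : Fin m × Option (Fin m) → MvPolynomial (σ n) NNReal),
      m ≤ 2 ^ ((Nat.log 2 n + c) ^ c) ∧
      (∀ e, (φ e).support.card ≤ 2 ^ ((Nat.log 2 n + c) ^ c) ∧ (φ e).totalDegree ≤ 2 ^ ((Nat.log 2 n + c) ^ c) ∧
        (ψ e).support.card ≤ 2 ^ ((Nat.log 2 n + c) ^ c) ∧ (ψ e).totalDegree ≤ 2 ^ ((Nat.log 2 n + c) ^ c) ∧
        (χ e).support.card ≤ 2 ^ ((Nat.log 2 n + c) ^ c) ∧ (χ e).totalDegree ≤ 2 ^ ((Nat.log 2 n + c) ^ c)) ∧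
      A.det = MvPolynomial.map NNReal.toRealHom (f n) ∧
      ((Literature.Barriers.ValiantsHypothesis.stLaplacian ℝ m).map
          (MvPolynomial.bind₁ fun e => MvPolynomial.map NNReal.toRealHom (φ e))).det ≠ 0 ∧
      ((Literature.Barriers.ValiantsHypothesis.stLaplacian ℝ m).map
          (MvPolynomial.bind₁ fun e => MvPolynomial.map NNReal.toRealHom (ψ e))).det ≠ 0 ∧
      (Literature.Barriers.ValiantsHypothesis.stLaplacian ℝ m).map
          (MvPolynomial.bind₁ fun e => MvPolynomial.map NNReal.toRealHom (ψ e)) * A *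
        (Literature.Barriers.ValiantsHypothesis.stLaplacian ℝ m).map
          (MvPolynomial.bind₁ fun e => MvPolynomial.map NNReal.toRealHom (φ e)) =
        (Literature.Barriers.ValiantsHypothesis.stLaplacian ℝ m).map
          (MvPolynomial.bind₁ fun e => MvPolynomial.map NNReal.toRealHom (χ e))

/-- STUB 1 statement — **the forest-quotient normal form** (THE BET; `J = 1` arborescence quotient with
POLYNOMIAL arc labels and two denominators, the common core of this line and of line `arborescence-span`):
for every 0/1 family whose complexification is in `VP_ℂ` there is `c` such that for every `n` there are `m`
and data `φ, ψ, χ` of size `≤ 2^{(log₂ n + c)^c}` (number of nodes, monomials per datum, degree per datum) with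
`ST_m(φ) ≠ 0`, `ST_m(ψ) ≠ 0` and `ST_m(χ) = ST_m(ψ) · f_n · ST_m(φ)` in `ℝ≥0[σ_n]`.  Implied by the crux with a
quasi-polynomial cofactor-DEGREE clause (`forestQuotient_of_zeroOneTransferDeg`); implies the crux
(`divisionEasy_of_forestQuotient`).  OPEN; decisive instance: the triangular-lattice dimers `D_n` of crux 5067.
[cite: FominGrigorievKoshevoy2014, Thm 7.2 and Remark 1.5] [cite: HrubesYehudayoff2021, §6] -/
def ForestQuotient : Prop :=
  ∀ (σ : ℕ → Type) [∀ n, Fintype (σ n)] (f : ∀ n, MvPolynomial (σ n) NNReal),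
    (∀ n m, MvPolynomial.coeff m (f n) = 0 ∨ MvPolynomial.coeff m (f n) = 1) →
    Literature.Computability.AlgebraicComplexity.IsVPFamily (k := ℂ)
      (fun n => MvPolynomial.map (Complex.ofRealHom.comp NNReal.toRealHom) (f n)) →
    ∃ c : ℕ, ∀ n : ℕ, ∃ (m : ℕ) (φ ψ χ : Fin m × Option (Fin m) → MvPolynomial (σ n) NNReal),
      m ≤ 2 ^ ((Nat.log 2 n + c) ^ c) ∧
      (∀ e, (φ e).support.card ≤ 2 ^ ((Nat.log 2 n + c) ^ c) ∧ (φ e).totalDegree ≤ 2 ^ ((Nat.log 2 n + c) ^ c) ∧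
        (ψ e).support.card ≤ 2 ^ ((Nat.log 2 n + c) ^ c) ∧ (ψ e).totalDegree ≤ 2 ^ ((Nat.log 2 n + c) ^ c) ∧
        (χ e).support.card ≤ 2 ^ ((Nat.log 2 n + c) ^ c) ∧ (χ e).totalDegree ≤ 2 ^ ((Nat.log 2 n + c) ^ c)) ∧
      MvPolynomial.aeval φ (Literature.Barriers.ValiantsHypothesis.stPoly NNReal m) ≠ 0 ∧
      MvPolynomial.aeval ψ (Literature.Barriers.ValiantsHypothesis.stPoly NNReal m) ≠ 0 ∧
      MvPolynomial.aeval χ (Literature.Barriers.ValiantsHypothesis.stPoly NNReal m) =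
        MvPolynomial.aeval ψ (Literature.Barriers.ValiantsHypothesis.stPoly NNReal m) * f n *
          MvPolynomial.aeval φ (Literature.Barriers.ValiantsHypothesis.stPoly NNReal m)

/-- STUB 2 statement — **division certificates transport along arbitrary monotone substitutions** (zero data
included): for `p ∈ ℝ≥0[ι]` (`ι` finite), any `φ : ι → ℝ≥0[τ]` and any nonzero cofactor `h` there is a nonzero
`h'` with `L(p(φ)·h') ≤ L(p·h) + Σ_i L(φ i)` and `L(h') ≤ L(h) + Σ_i L(φ i)`.  Proof route: `Z := {i | φ i = 0}`,
`w` its indicator weight, `φ'` := `φ` off `Z` and `1` on `Z`; `h' := (bot_w h)(φ')` (bottom forms are free and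
multiplicative over `ℝ≥0`: `complexity_botComponent_le`, `botComponent_mul`, `botComponent_ne_zero`,
`aeval_eq_aeval_botComponent`, `aeval_eq_zero_of_botDegree_ne_zero` of `Theorems/DivisionGapZeroOneTransferProjClosure{,Aux}`;
substitution cost `complexity_aeval_le`; nonvanishing by evaluation at the all-ones point).  Generalises the landed
`stub_projClosure` (projections) and `Negative.Faces.divComplexity_aeval_le_of_pos` (nonzero constants). [folklore] -/
def DivSubstClosure : Prop :=
  ∀ (ι τ : Type) [Fintype ι] (p : MvPolynomial ι NNReal) (φ : ι → MvPolynomial τ NNReal)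
    (h : MvPolynomial ι NNReal), h ≠ 0 →
    ∃ h' : MvPolynomial τ NNReal, h' ≠ 0 ∧
      Literature.Computability.AlgebraicComplexity.complexity (MvPolynomial.aeval φ p * h') ≤
        Literature.Computability.AlgebraicComplexity.complexity (p * h) +
          ∑ i, Literature.Computability.AlgebraicComplexity.complexity (φ i) ∧
      Literature.Computability.AlgebraicComplexity.complexity h' ≤
        Literature.Computability.AlgebraicComplexity.complexity h +
          ∑ i, Literature.Computability.AlgebraicComplexity.complexity (φ i)

/-- STUB 3 statement — **sparse polynomials are cheap**: a polynomial over `ℝ≥0` with `≤ T` monomials, each of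
degree `≤ T`, has fan-in-two complexity `≤ 2T² + 2T` (write it as the sum of its monomials: `as_sum`,
`complexity_finset_sum_le`, `complexity_finset_prod_le`, `complexity_pow_le`, `complexity_smul_le`). [folklore] -/
def SparsePolyComplexity : Prop :=
  ∀ (τ : Type) (T : ℕ) (q : MvPolynomial τ NNReal), q.support.card ≤ T → q.totalDegree ≤ T →
    Literature.Computability.AlgebraicComplexity.complexity q ≤ 2 * T * T + 2 * T

/-- THE ENGINE (the planner's `stub_subMarkovDetDivisionEasy`, verbatim; now a THEOREM of stubs 2 and 3, see
`subMarkovDetDivisionEasy_of`): there is an absolute `K` such that for all `m ≤ T`, `2 ≤ T`, and every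
substitution `φ` of the arc variables of `ST_m` by polynomials over `ℝ≥0` with `≤ T` monomials of degree `≤ T`,
the forest polynomial `ST_m(φ)` has division complexity `≤ T^K`. [cite: FominGrigorievKoshevoy2014, Thm 7.2 and Lemma 7.3] -/
def SubMarkovDetDivisionEasy : Prop :=
  ∃ K : ℕ, ∀ (m T : ℕ) (τ : Type) (φ : Fin m × Option (Fin m) → MvPolynomial τ NNReal),
    2 ≤ T → m ≤ T → (∀ e, (φ e).support.card ≤ T ∧ (φ e).totalDegree ≤ T) →
    ∃ h : MvPolynomial τ NNReal, h ≠ 0 ∧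
      Literature.Computability.AlgebraicComplexity.complexity
          (MvPolynomial.aeval φ (Literature.Barriers.ValiantsHypothesis.stPoly NNReal m) * h) ≤ T ^ K ∧
      Literature.Computability.AlgebraicComplexity.complexity h ≤ T ^ K

/-! ### The registered stubs (`sorry` lives only here) -/

/-- **STUB 1 (THE BET, crux-strength) — the forest-quotient normal form** (`ForestQuotient`).  Why it might fail:
a 0/1 `VP_ℂ` family that is no quasi-polynomial forest quotient — first suspect the triangular-lattice dimers
`D_n` (crux 5067, `VP` by Kasteleyn); a refutation is a division LOWER bound (HrubesYehudayoff2021 §6 Problem 3,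
open).  Implied by the crux plus a quasi-polynomial cofactor-degree clause (`forestQuotient_of_zeroOneTransferDeg`).
[cite: FominGrigorievKoshevoy2014, Remark 1.5] [cite: HrubesYehudayoff2021, §6] -/
theorem stub_forestQuotient :
    ∀ (σ : ℕ → Type) [∀ n, Fintype (σ n)] (f : ∀ n, MvPolynomial (σ n) NNReal),
      (∀ n m, MvPolynomial.coeff m (f n) = 0 ∨ MvPolynomial.coeff m (f n) = 1) →
      Literature.Computability.AlgebraicComplexity.IsVPFamily (k := ℂ)
        (fun n => MvPolynomial.map (Complex.ofRealHom.comp NNReal.toRealHom) (f n)) →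
      ∃ c : ℕ, ∀ n : ℕ, ∃ (m : ℕ) (φ ψ χ : Fin m × Option (Fin m) → MvPolynomial (σ n) NNReal),
        m ≤ 2 ^ ((Nat.log 2 n + c) ^ c) ∧
        (∀ e, (φ e).support.card ≤ 2 ^ ((Nat.log 2 n + c) ^ c) ∧ (φ e).totalDegree ≤ 2 ^ ((Nat.log 2 n + c) ^ c) ∧
          (ψ e).support.card ≤ 2 ^ ((Nat.log 2 n + c) ^ c) ∧ (ψ e).totalDegree ≤ 2 ^ ((Nat.log 2 n + c) ^ c) ∧
          (χ e).support.card ≤ 2 ^ ((Nat.log 2 n + c) ^ c) ∧ (χ e).totalDegree ≤ 2 ^ ((Nat.log 2 n + c) ^ c)) ∧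
        MvPolynomial.aeval φ (Literature.Barriers.ValiantsHypothesis.stPoly NNReal m) ≠ 0 ∧
        MvPolynomial.aeval ψ (Literature.Barriers.ValiantsHypothesis.stPoly NNReal m) ≠ 0 ∧
        MvPolynomial.aeval χ (Literature.Barriers.ValiantsHypothesis.stPoly NNReal m) =
          MvPolynomial.aeval ψ (Literature.Barriers.ValiantsHypothesis.stPoly NNReal m) * f n *
            MvPolynomial.aeval φ (Literature.Barriers.ValiantsHypothesis.stPoly NNReal m) := by
  sorry

/-- **STUB 2 (M) — division certificates transport along arbitrary monotone polynomial substitutions**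
(`DivSubstClosure`).  LANDED (wave 1, p107876): the tree theorem
`Theorems.DivisionGapZeroOneTransfer.stub_divSubstClosure` (file `DivisionGapZeroOneTransferDivSubstClosure.lean`). [folklore] -/
theorem stub_divSubstClosure :
    ∀ (ι τ : Type) [Fintype ι] (p : MvPolynomial ι NNReal) (φ : ι → MvPolynomial τ NNReal)
      (h : MvPolynomial ι NNReal), h ≠ 0 →
      ∃ h' : MvPolynomial τ NNReal, h' ≠ 0 ∧
        Literature.Computability.AlgebraicComplexity.complexity (MvPolynomial.aeval φ p * h') ≤
          Literature.Computability.AlgebraicComplexity.complexity (p * h) +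
            ∑ i, Literature.Computability.AlgebraicComplexity.complexity (φ i) ∧
        Literature.Computability.AlgebraicComplexity.complexity h' ≤
          Literature.Computability.AlgebraicComplexity.complexity h +
            ∑ i, Literature.Computability.AlgebraicComplexity.complexity (φ i) :=
  Summit.ValiantsHypothesis.ValiantsHypothesis.Theorems.DivisionGapZeroOneTransfer.stub_divSubstClosure

/-- **STUB 3 (S) — sparse polynomials are cheap** (`SparsePolyComplexity`): `L(q) ≤ 2T² + 2T` for `q` with
`≤ T` monomials of degree `≤ T`.  LANDED (wave 1, p108190): the tree theorem
`Theorems.DivisionGapZeroOneTransfer.stub_sparsePolyComplexity` (file `DivisionGapZeroOneTransferSparsePolyComplexity.lean`). [folklore] -/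
theorem stub_sparsePolyComplexity :
    ∀ (τ : Type) (T : ℕ) (q : MvPolynomial τ NNReal), q.support.card ≤ T → q.totalDegree ≤ T →
      Literature.Computability.AlgebraicComplexity.complexity q ≤ 2 * T * T + 2 * T :=
  Summit.ValiantsHypothesis.ValiantsHypothesis.Theorems.DivisionGapZeroOneTransfer.stub_sparsePolyComplexity

/-! ### Consistency: each named statement IS its registered stub (definitionally) -/

theorem forestQuotient_holds : ForestQuotient := stub_forestQuotient
theorem divSubstClosure_holds : DivSubstClosure := stub_divSubstClosure
theorem sparsePolyComplexity_holds : SparsePolyComplexity := stub_sparsePolyComplexity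

/-! ### Name-keyed aliases (the hypotheses of the composition; the skeleton audit admits a hypothesis only
if its head constant is a registered obligation or is named like a declared stub) -/
namespace Registered

/-- Alias of `ForestQuotient` keyed by the registered stub name. -/
abbrev stub_forestQuotient : Prop := ForestQuotient
/-- Alias of `DivSubstClosure` keyed by the registered stub name. -/
abbrev stub_divSubstClosure : Prop := DivSubstClosure
/-- Alias of `SparsePolyComplexity` keyed by the registered stub name. -/
abbrev stub_sparsePolyComplexity : Prop := SparsePolyComplexity

end Registered

/-! ### Proved glue 1: forest expansion (matrix-tree theorem transported along the substitution) -/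

/-- Injectivity of `ℝ≥0 → ℝ` on polynomials. [folklore] -/
theorem map_toRealHom_injective {τ : Type} :
    Function.Injective (MvPolynomial.map (σ := τ) NNReal.toRealHom) :=
  MvPolynomial.map_injective _ (fun a b h => NNReal.coe_injective (by simpa using h))

/-- **Forest expansion.**  `det L(φ) = ST_m(φ) ⊗ ℝ` — `det_stLaplacian` (Tutte/Moon) pushed through the
ring hom `bind₁ (φ ⊗ ℝ)`. [folklore] -/
theorem det_pencil {m : ℕ} {τ : Type} (φ : Fin m × Option (Fin m) → MvPolynomial τ ℝ≥0) :
    ((stLaplacian ℝ m).map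
        (MvPolynomial.bind₁ fun e => MvPolynomial.map NNReal.toRealHom (φ e))).det =
      MvPolynomial.map NNReal.toRealHom (MvPolynomial.aeval φ (stPoly ℝ≥0 m)) := by
  classical
  set g : MvPolynomial (Fin m × Option (Fin m)) ℝ →ₐ[ℝ] MvPolynomial τ ℝ :=
    MvPolynomial.bind₁ fun e => MvPolynomial.map NNReal.toRealHom (φ e) with hg
  have h1 : ((stLaplacian ℝ m).map g).det = g (stLaplacian ℝ m).det := by
    rw [AlgHom.map_det, AlgHom.mapMatrix_apply]
  rw [h1, det_stLaplacian]
  simp only [hg, stPoly, map_sum, map_prod, MvPolynomial.bind₁_X_right, MvPolynomial.aeval_X]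

/-- A pencil with nonzero determinant has a nonzero forest polynomial. [folklore] -/
theorem forest_ne_zero {m : ℕ} {τ : Type} {φ : Fin m × Option (Fin m) → MvPolynomial τ ℝ≥0}
    (h : ((stLaplacian ℝ m).map
        (MvPolynomial.bind₁ fun e => MvPolynomial.map NNReal.toRealHom (φ e))).det ≠ 0) :
    MvPolynomial.aeval φ (stPoly ℝ≥0 m) ≠ 0 := by
  intro h0
  apply h
  rw [det_pencil, h0, map_zero]

/-- **The intertwining identity on the semiring side.**  From `X'·A·X = Y` with `X' = L(ψ)`, `X = L(φ)`,
`Y = L(χ)` and `det A = g ⊗ ℝ`: `ST(χ) = ST(ψ) · g · ST(φ)` in `ℝ≥0[τ]`. [folklore] -/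
theorem forest_identity {m : ℕ} {τ : Type} {A : Matrix (Fin m) (Fin m) (MvPolynomial τ ℝ)}
    {g : MvPolynomial τ ℝ≥0} {φ ψ χ : Fin m × Option (Fin m) → MvPolynomial τ ℝ≥0}
    (hA : A.det = MvPolynomial.map NNReal.toRealHom g)
    (hXAX : (stLaplacian ℝ m).map
          (MvPolynomial.bind₁ fun e => MvPolynomial.map NNReal.toRealHom (ψ e)) * A *
        (stLaplacian ℝ m).map
          (MvPolynomial.bind₁ fun e => MvPolynomial.map NNReal.toRealHom (φ e)) =
        (stLaplacian ℝ m).map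
          (MvPolynomial.bind₁ fun e => MvPolynomial.map NNReal.toRealHom (χ e))) :
    MvPolynomial.aeval χ (stPoly ℝ≥0 m) =
      MvPolynomial.aeval ψ (stPoly ℝ≥0 m) * g * MvPolynomial.aeval φ (stPoly ℝ≥0 m) := by
  have h := congrArg Matrix.det hXAX
  rw [Matrix.det_mul, Matrix.det_mul, det_pencil, det_pencil, det_pencil, hA, ← map_mul, ← map_mul] at h
  exact (map_toRealHom_injective h).symm

/-- **Hidden-Markov certificates are forest quotients** (`forest_identity` + `forest_ne_zero`, per `n`):
the planner's two-sided statement implies the registered bet. [folklore] -/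
theorem forestQuotient_of_hiddenMarkovUniversality (hU : HiddenMarkovUniversality) : ForestQuotient := by
  intro σ _ f h01 hVP
  obtain ⟨c, hc⟩ := hU σ f h01 hVP
  refine ⟨c, fun n => ?_⟩
  obtain ⟨m, A, φ, ψ, χ, hm, hdata, hdetA, hX, hX', hXAX⟩ := hc n
  exact ⟨m, φ, ψ, χ, hm, hdata, forest_ne_zero hX, forest_ne_zero hX', forest_identity hdetA hXAX⟩

/-! ### Proved glue 2: the converse normal form — positive `ST`-spans are forest quotients -/

/-- The unit data: slack `1` at every node, all arcs `0`. [folklore] -/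
def unitData (m : ℕ) (τ : Type) : Fin m × Option (Fin m) → MvPolynomial τ ℝ≥0 :=
  fun e => if e.2 = none then 1 else 0

/-- **`ST_m(unit data) = 1`**: only the root star survives. [folklore] -/
theorem forest_unit (m : ℕ) (τ : Type) :
    MvPolynomial.aeval (unitData m τ) (stPoly ℝ≥0 m) = 1 := by
  classical
  unfold stPoly
  rw [map_sum]
  rw [Finset.sum_eq_single_of_mem (fun _ : Fin m => (none : Option (Fin m)))
    (Finset.mem_filter.mpr ⟨Finset.mem_univ _, isArborescence_star⟩)]
  · rw [map_prod]
    exact Finset.prod_eq_one fun i _ => by simp [unitData]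
  · intro t _ ht
    -- some node does not point to the root: its factor is the zero datum
    have : ∃ i, t i ≠ none := by
      by_contra hcon
      push Not at hcon
      exact ht (funext hcon)
    obtain ⟨i, hi⟩ := this
    rw [map_prod]
    apply Finset.prod_eq_zero (Finset.mem_univ i)
    simp [unitData, hi]

/-- The unit data are sparse (at most one monomial, degree `0`). [folklore] -/
theorem unitData_sparse (m : ℕ) (τ : Type) (e : Fin m × Option (Fin m)) :
    (unitData m τ e).support.card ≤ 1 ∧ (unitData m τ e).totalDegree ≤ 1 := by
  classical
  unfold unitData
  split_ifs
  · constructor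
    · rw [← C_1, C_apply]
      exact (Finset.card_le_card support_monomial_subset).trans (by simp)
    · rw [totalDegree_one]; exact Nat.zero_le _
  · simp

/-- Projection labels are sparse (at most one monomial, degree `≤ 1`). [folklore] -/
theorem label_sparse {ι τ : Type} {a : ι → MvPolynomial τ ℝ≥0}
    (ha : ∀ i, (∃ j, a i = X j) ∨ ∃ c, a i = C c) (i : ι) :
    (a i).support.card ≤ 1 ∧ (a i).totalDegree ≤ 1 := by
  classical
  rcases ha i with ⟨j, hj⟩ | ⟨c, hc⟩
  · rw [hj]
    constructor
    · rw [X, support_monomial]; split_ifs <;> simp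
    · rw [totalDegree_X]
  · rw [hc]
    constructor
    · rw [C_apply]
      exact (Finset.card_le_card support_monomial_subset).trans (by simp)
    · rw [totalDegree_C]; exact Nat.zero_le _

/-- **Positive `ST`-spans are forest quotients.**  If every 0/1 `VP_ℂ` family satisfies `f_n · A = B` with
`A, B` positive Valiant projections of `ST_N` (`A ≠ 0`, `N` quasi-polynomial) — the `I = J = 1` output form of
line `arborescence-span` — then `ForestQuotient` holds: `m := N`, `φ :=` the labels of `A`, `χ :=` the labels of
`B`, `ψ :=` unit data (`ST_N(ψ) = 1`). [folklore] -/
theorem forestQuotient_of_span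
    (H : ∀ (σ : ℕ → Type) [∀ n, Fintype (σ n)] (f : ∀ n, MvPolynomial (σ n) ℝ≥0),
      (∀ n m, MvPolynomial.coeff m (f n) = 0 ∨ MvPolynomial.coeff m (f n) = 1) →
      IsVPFamily (k := ℂ) (fun n => MvPolynomial.map (Complex.ofRealHom.comp NNReal.toRealHom) (f n)) →
      ∃ c : ℕ, ∀ n, ∃ N ≤ 2 ^ ((Nat.log 2 n + c) ^ c), ∃ A B : MvPolynomial (σ n) ℝ≥0,
        IsProjection A (stPoly ℝ≥0 N) ∧ IsProjection B (stPoly ℝ≥0 N) ∧ A ≠ 0 ∧ f n * A = B) :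
    ForestQuotient := by
  intro σ _ f h01 hVP
  obtain ⟨c, hc⟩ := H σ f h01 hVP
  refine ⟨c, fun n => ?_⟩
  obtain ⟨N, hN, A, B, ⟨a, ha, hA⟩, ⟨b, hb, hB⟩, hA0, hAB⟩ := hc n
  have hE : 1 ≤ 2 ^ ((Nat.log 2 n + c) ^ c) := Nat.one_le_two_pow
  refine ⟨N, a, unitData N (σ n), b, hN, fun e => ⟨?_, ?_, ?_, ?_, ?_, ?_⟩, ?_, ?_, ?_⟩
  · exact (label_sparse ha e).1.trans hE
  · exact (label_sparse ha e).2.trans hE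
  · exact (unitData_sparse N (σ n) e).1.trans hE
  · exact (unitData_sparse N (σ n) e).2.trans hE
  · exact (label_sparse hb e).1.trans hE
  · exact (label_sparse hb e).2.trans hE
  · rw [← hA]; exact hA0
  · rw [forest_unit]; exact one_ne_zero
  · rw [forest_unit, one_mul, ← hA, ← hB, hAB]

/-- **The bet is implied by the crux WITH a quasi-polynomial cofactor-degree clause** (`ZOT_deg`): the tree's
converse normal form `span_of_zeroOneTransferDeg` (line `arborescence-span`, p96452) followed by
`forestQuotient_of_span`.  So `stub_forestQuotient` sits between `ZOT_deg` and the crux, exactly like S2.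
[folklore] -/
theorem forestQuotient_of_zeroOneTransferDeg
    (H : ∀ (σ : ℕ → Type) [∀ n, Fintype (σ n)] (f : ∀ n, MvPolynomial (σ n) NNReal),
      (∀ n m, MvPolynomial.coeff m (f n) = 0 ∨ MvPolynomial.coeff m (f n) = 1) →
      Literature.Computability.AlgebraicComplexity.IsVPFamily (k := ℂ)
        (fun n => MvPolynomial.map (Complex.ofRealHom.comp NNReal.toRealHom) (f n)) →
      ∃ c : ℕ, ∀ n, ∃ h : MvPolynomial (σ n) NNReal, h ≠ 0 ∧
        h.totalDegree ≤ 2 ^ ((Nat.log 2 n + c) ^ c) ∧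
        Literature.Computability.AlgebraicComplexity.complexity (f n * h) +
          Literature.Computability.AlgebraicComplexity.complexity h ≤ 2 ^ ((Nat.log 2 n + c) ^ c)) :
    ForestQuotient :=
  forestQuotient_of_span fun σ _ f h01 hVP =>
    Summit.ValiantsHypothesis.ValiantsHypothesis.Theorems.DivisionGapZeroOneTransfer.span_of_zeroOneTransferDeg
      H σ f h01 hVP

/-! ### Proved glue 3: the quasi-polynomial bookkeeping -/

/-- `6·B + 4 ≤ 2^{(a + c)^c}` for `c = c₁ + K + 4` whenever `B ≤ (2^{(a+c₁)^{c₁}})^K`. [folklore] -/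
theorem qp_arith (a c₁ K : ℕ) {B : ℕ} (hB : B ≤ (2 ^ ((a + c₁) ^ c₁)) ^ K) :
    6 * B + 4 ≤ 2 ^ ((a + (c₁ + K + 4)) ^ (c₁ + K + 4)) := by
  set E₁ := (a + c₁) ^ c₁ with hE₁
  have hE : 1 ≤ E₁ := by
    rcases Nat.eq_zero_or_pos c₁ with h | h
    · simp [hE₁, h]
    · exact Nat.one_le_pow _ _ (by omega)
  have hB' : B ≤ 2 ^ (E₁ * K) := by rwa [← pow_mul] at hB
  have hpos : 1 ≤ 2 ^ (E₁ * K) := Nat.one_le_two_pow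
  have h1 : 6 * B + 4 ≤ 2 ^ (E₁ * K + 4) := by
    calc 6 * B + 4 ≤ 16 * 2 ^ (E₁ * K) := by omega
      _ = 2 ^ (E₁ * K + 4) := by ring
  refine h1.trans (Nat.pow_le_pow_right (by norm_num) ?_)
  have h2 : E₁ ≤ (a + (c₁ + K + 4)) ^ c₁ := Nat.pow_le_pow_left (by omega) _
  have h3 : K + 4 ≤ (a + (c₁ + K + 4)) ^ (K + 4) :=
    calc K + 4 ≤ a + (c₁ + K + 4) := by omega
      _ = (a + (c₁ + K + 4)) ^ 1 := (pow_one _).symm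
      _ ≤ (a + (c₁ + K + 4)) ^ (K + 4) := Nat.pow_le_pow_right (by omega) (by omega)
  calc E₁ * K + 4 ≤ E₁ * K + 4 * E₁ := by nlinarith
    _ = E₁ * (K + 4) := by ring
    _ ≤ (a + (c₁ + K + 4)) ^ c₁ * (a + (c₁ + K + 4)) ^ (K + 4) := Nat.mul_le_mul h2 h3
    _ = (a + (c₁ + K + 4)) ^ (c₁ + K + 4) := by ring

/-- The engine's arithmetic: `2(m+1)^4 + m(m+1)(2T²+2T) ≤ T^10` for `2 ≤ T`, `m ≤ T`. [folklore] -/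
theorem arith_engine {m T : ℕ} (hT : 2 ≤ T) (hm : m ≤ T) :
    2 * (m + 1) ^ 4 + m * (m + 1) * (2 * T * T + 2 * T) ≤ T ^ 10 := by
  have h1 : m + 1 ≤ 2 * T := by omega
  have h2 : (m + 1) ^ 4 ≤ (2 * T) ^ 4 := Nat.pow_le_pow_left h1 4
  have h3 : m * (m + 1) ≤ T * (2 * T) := Nat.mul_le_mul hm h1
  have h4 : 2 * T * T + 2 * T ≤ 3 * T * T := by nlinarith
  have h5 : 64 ≤ T ^ 6 :=
    calc 64 = 2 ^ 6 := by norm_num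
      _ ≤ T ^ 6 := Nat.pow_le_pow_left hT 6
  calc 2 * (m + 1) ^ 4 + m * (m + 1) * (2 * T * T + 2 * T)
      ≤ 2 * (2 * T) ^ 4 + T * (2 * T) * (3 * T * T) :=
        Nat.add_le_add (Nat.mul_le_mul_left 2 h2) (Nat.mul_le_mul h3 h4)
    _ = 38 * T ^ 4 := by ring
    _ ≤ T ^ 6 * T ^ 4 := Nat.mul_le_mul_right _ (by omega)
    _ = T ^ 10 := by ring

/-! ### The engine from stubs 2 and 3 -/

/-- **The engine is a theorem of `DivSubstClosure` and `SparsePolyComplexity`** (with the tree's star–mesh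
certificate `exists_stPoly_mul`: `F = ST_m · h₀`, `h₀ > 0` at positive points, `L(F), L(h₀) ≤ 2(m+1)^4`):
transport the certificate along `φ` at cost `Σ_e L(φ e) ≤ m(m+1)(2T²+2T)`; `K := 10`. [cite: FominGrigorievKoshevoy2014, Thm 7.2] -/
theorem subMarkovDetDivisionEasy_of (hS : DivSubstClosure) (hP : SparsePolyComplexity) :
    SubMarkovDetDivisionEasy := by
  refine ⟨10, fun m T τ φ hT hm hφ => ?_⟩
  obtain ⟨F, h₀, hF, hpos, hcF, hch⟩ := Summit.ValiantsHypothesis.DivisionGap.exists_stPoly_mul m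
  have h₀ne : h₀ ≠ 0 := by
    intro h0
    have := hpos (fun _ => 1) (fun _ => one_pos)
    rw [h0, map_zero] at this
    exact lt_irrefl _ this
  obtain ⟨h', h'ne, hb1, hb2⟩ := hS _ _ (stPoly ℝ≥0 m) φ h₀ h₀ne
  have hsum : ∑ e, complexity (φ e) ≤ m * (m + 1) * (2 * T * T + 2 * T) := by
    calc ∑ e, complexity (φ e) ≤ ∑ _e : Fin m × Option (Fin m), (2 * T * T + 2 * T) :=
          Finset.sum_le_sum fun e _ => hP τ T (φ e) (hφ e).1 (hφ e).2
      _ = m * (m + 1) * (2 * T * T + 2 * T) := by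
          rw [Finset.sum_const, Finset.card_univ, Fintype.card_prod, Fintype.card_option,
            Fintype.card_fin, smul_eq_mul]
  have hcF' : complexity (stPoly ℝ≥0 m * h₀) ≤ 2 * (m + 1) ^ 4 := by rw [← hF]; exact hcF
  refine ⟨h', h'ne, ?_, ?_⟩
  · calc complexity (aeval φ (stPoly ℝ≥0 m) * h')
        ≤ complexity (stPoly ℝ≥0 m * h₀) + ∑ e, complexity (φ e) := hb1
      _ ≤ 2 * (m + 1) ^ 4 + m * (m + 1) * (2 * T * T + 2 * T) := add_le_add hcF' hsum
      _ ≤ T ^ 10 := arith_engine hT hm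
  · calc complexity h' ≤ complexity h₀ + ∑ e, complexity (φ e) := hb2
      _ ≤ 2 * (m + 1) ^ 4 + m * (m + 1) * (2 * T * T + 2 * T) := add_le_add hch hsum
      _ ≤ T ^ 10 := arith_engine hT hm

/-! ### The composition: bet + engine imply the crux, BY NAME -/

/-- **The crux's body from `ForestQuotient` and the engine** (pure logic; no `sorry`).  Given a 0/1 family `f`
with `f ⊗ ℂ ∈ VP_ℂ`: `ForestQuotient` gives, for every `n`, data `(m, φ, ψ, χ)` of size
`≤ T := 2^{(log₂ n + c₁)^{c₁}}` with `ST(χ) = ST(ψ)·f_n·ST(φ)`, `ST(φ), ST(ψ) ≠ 0`; the engine gives nonzero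
`h₁, h₂, h₃` with `L₊(ST(φ)h₁), L₊(h₁), L₊(ST(ψ)h₂), L₊(h₂), L₊(ST(χ)h₃), L₊(h₃) ≤ T^K`; the cofactor
`h := (ST(φ)h₁)(ST(ψ)h₂)h₃ ≠ 0` has `f_n·h = (ST(χ)h₃)h₁h₂`, so `L₊(f_n h) + L₊(h) ≤ 6T^K + 4 ≤
2^{(log₂ n + c)^c}` with `c = c₁ + K + 4` (`qp_arith`).  Stated with the crux UNFOLDED so that
`ZeroOneTransfer_of` stays the only theorem concluding the crux by name. [folklore] -/
theorem divisionEasy_of_forestQuotient (hQ : ForestQuotient) (hE : SubMarkovDetDivisionEasy) :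
    ∀ (σ : ℕ → Type) [∀ n, Fintype (σ n)] (f : ∀ n, MvPolynomial (σ n) NNReal),
      (∀ n m, MvPolynomial.coeff m (f n) = 0 ∨ MvPolynomial.coeff m (f n) = 1) →
      IsVPFamily (k := ℂ) (fun n => MvPolynomial.map (Complex.ofRealHom.comp NNReal.toRealHom) (f n)) →
      ∃ c : ℕ, ∀ n, ∃ h : MvPolynomial (σ n) NNReal, h ≠ 0 ∧
        complexity (f n * h) + complexity h ≤ 2 ^ ((Nat.log 2 n + c) ^ c) := by
  intro σ _ f h01 hVP
  -- (1) the forest-quotient certificates and the engine constant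
  obtain ⟨c₁, hc₁⟩ := hQ σ f h01 hVP
  obtain ⟨K, hK⟩ := hE
  refine ⟨c₁ + K + 4, fun n => ?_⟩
  obtain ⟨m, φ, ψ, χ, hm, hdata, hφ0, hψ0, key⟩ := hc₁ n
  set T : ℕ := 2 ^ ((Nat.log 2 n + c₁) ^ c₁) with hT
  have hT2 : 2 ≤ T := by
    have hE : 1 ≤ (Nat.log 2 n + c₁) ^ c₁ := by
      rcases Nat.eq_zero_or_pos c₁ with h | h
      · simp [h]
      · exact Nat.one_le_pow _ _ (by omega)
    calc (2 : ℕ) = 2 ^ 1 := (pow_one 2).symm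
      _ ≤ 2 ^ ((Nat.log 2 n + c₁) ^ c₁) := Nat.pow_le_pow_right (by norm_num) hE
  -- (2) the three forest polynomials are division-easy
  obtain ⟨h₁, h₁0, hF₁, hh₁⟩ := hK m T (σ n) φ hT2 hm (fun e => ⟨(hdata e).1, (hdata e).2.1⟩)
  obtain ⟨h₂, h₂0, hF₂, hh₂⟩ := hK m T (σ n) ψ hT2 hm (fun e => ⟨(hdata e).2.2.1, (hdata e).2.2.2.1⟩)
  obtain ⟨h₃, h₃0, hF₃, hh₃⟩ := hK m T (σ n) χ hT2 hm (fun e => ⟨(hdata e).2.2.2.2.1, (hdata e).2.2.2.2.2⟩)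
  -- (3) quotient closure
  refine ⟨MvPolynomial.aeval φ (stPoly ℝ≥0 m) * h₁ * (MvPolynomial.aeval ψ (stPoly ℝ≥0 m) * h₂) * h₃,
    mul_ne_zero (mul_ne_zero (mul_ne_zero hφ0 h₁0) (mul_ne_zero hψ0 h₂0)) h₃0, ?_⟩
  have e1 : f n * (MvPolynomial.aeval φ (stPoly ℝ≥0 m) * h₁ *
      (MvPolynomial.aeval ψ (stPoly ℝ≥0 m) * h₂) * h₃) =
      MvPolynomial.aeval χ (stPoly ℝ≥0 m) * h₃ * h₁ * h₂ := by
    rw [key]; ring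
  rw [e1]
  have hmul := complexity_mul_le_holds (k := ℝ≥0) (σ := σ n)
  have b1 : complexity (MvPolynomial.aeval χ (stPoly ℝ≥0 m) * h₃ * h₁ * h₂) ≤ 3 * T ^ K + 2 :=
    calc complexity (MvPolynomial.aeval χ (stPoly ℝ≥0 m) * h₃ * h₁ * h₂)
        ≤ complexity (MvPolynomial.aeval χ (stPoly ℝ≥0 m) * h₃ * h₁) + complexity h₂ + 1 := hmul _ _
      _ ≤ (complexity (MvPolynomial.aeval χ (stPoly ℝ≥0 m) * h₃) + complexity h₁ + 1) +
            complexity h₂ + 1 := by gcongr; exact hmul _ _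
      _ ≤ (T ^ K + T ^ K + 1) + T ^ K + 1 := by gcongr
      _ = 3 * T ^ K + 2 := by ring
  have b2 : complexity (MvPolynomial.aeval φ (stPoly ℝ≥0 m) * h₁ *
      (MvPolynomial.aeval ψ (stPoly ℝ≥0 m) * h₂) * h₃) ≤ 3 * T ^ K + 2 :=
    calc complexity (MvPolynomial.aeval φ (stPoly ℝ≥0 m) * h₁ *
          (MvPolynomial.aeval ψ (stPoly ℝ≥0 m) * h₂) * h₃)
        ≤ complexity (MvPolynomial.aeval φ (stPoly ℝ≥0 m) * h₁ *
            (MvPolynomial.aeval ψ (stPoly ℝ≥0 m) * h₂)) + complexity h₃ + 1 := hmul _ _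
      _ ≤ (complexity (MvPolynomial.aeval φ (stPoly ℝ≥0 m) * h₁) +
            complexity (MvPolynomial.aeval ψ (stPoly ℝ≥0 m) * h₂) + 1) + complexity h₃ + 1 := by
          gcongr; exact hmul _ _
      _ ≤ (T ^ K + T ^ K + 1) + T ^ K + 1 := by gcongr
      _ = 3 * T ^ K + 2 := by ring
  calc complexity (MvPolynomial.aeval χ (stPoly ℝ≥0 m) * h₃ * h₁ * h₂) +
        complexity (MvPolynomial.aeval φ (stPoly ℝ≥0 m) * h₁ *
          (MvPolynomial.aeval ψ (stPoly ℝ≥0 m) * h₂) * h₃)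
      ≤ (3 * T ^ K + 2) + (3 * T ^ K + 2) := add_le_add b1 b2
    _ = 6 * T ^ K + 4 := by ring
    _ ≤ 2 ^ ((Nat.log 2 n + (c₁ + K + 4)) ^ (c₁ + K + 4)) := qp_arith (Nat.log 2 n) c₁ K le_rfl

/-- **`ZeroOneTransfer` from the registered stubs, BY NAME**: the bet `stub_forestQuotient` (hypothesis) and the
engine (`subMarkovDetDivisionEasy_of` from the LANDED `stub_divSubstClosure` p107876 and `stub_sparsePolyComplexity`
p108190, discharged inside the proof; also landed standalone as `Theorems.DivisionGapZeroOneTransfer.stub_subMarkovDetDivisionEasy`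
p108680) fed into `divisionEasy_of_forestQuotient` is literally the crux. [folklore] -/
theorem ZeroOneTransfer_of (hQ : Registered.stub_forestQuotient) :
    Summit.ValiantsHypothesis.ValiantsHypothesis.Theses.DivisionGap.ZeroOneTransfer :=
  fun σ _ f h01 hVP =>
    divisionEasy_of_forestQuotient hQ
      (subMarkovDetDivisionEasy_of divSubstClosure_holds sparsePolyComplexity_holds) σ f h01 hVP

/-- Wiring check: the registered stubs feed `ZeroOneTransfer_of` as stated (after wave 1 the two engine stubs are
tree theorems and are discharged inside the proof; only the bet remains a hypothesis). -/
example : Summit.ValiantsHypothesis.ValiantsHypothesis.Theses.DivisionGap.ZeroOneTransfer :=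
  ZeroOneTransfer_of stub_forestQuotient

end Summit.ValiantsHypothesis.ValiantsHypothesis.Cruxes.ZeroOneTransfer.HiddenMarkovIntertwiner

end
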